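import Literature.Computability.Complexity.KarpProblems
import Literature.Computability.Complexity.FoldBricks
import Literature.Computability.Complexity.ListFoldChecks
import Literature.Computability.Complexity.NPClosureProofs
import Literature.Computability.Complexity.ReductionsProofs
import Literature.ModelTheory.FiniteModelTheory.ESOVerifier
import Literature.ModelTheory.FiniteModelTheory.ESODefinability
import HarnessLib

/-!
# `CHROMATIC NUMBER ∈ NP` (the membership half of the discharge of `isNPComplete_CHROMATIC`)

Karp 1972, §3–§4: the 21 problems are in `NP` because a nondeterministic algorithm may guess the
structure asked for (here a colouring `φ : N → ℤ_k`) and check it in polynomial time. In the tree,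
`NP = polyExists P` (certificates, Arora–Barak Def. 2.1), and the cheapest certified route to the
membership of a GRAPH problem is Fagin's easy direction, which the tree has PROVED
(`Literature.ModelTheory.FiniteModelTheory.eso_subset_NP_holds`, `ESOVerifier.lean`: every `∃SO`-definable class of
finite structures over a non-degenerate vocabulary has its language of codes in `NP`), together
with the closure of `NP` under Karp reductions (`mem_NP_of_karpReducible_holds`):

* the `∃SO` property. Over the vocabulary `[2, 1]` (a binary `E`, a unary `K`), the closed query
  `colQuery`: "`E` is symmetric and irreflexive, and there is a binary `C` with `∀ a ∃ c (K c ∧ C a c)`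
  and `∀ a b c ¬(E a b ∧ C a c ∧ C b c)`" is first-order (`isDef_colQuery`, by the closure API of
  `ESODefinability.lean`), so its class `classOf colQuery` is `∃SO`-definable and its language
  `COLQ` is in `NP` (`COLQ_mem_NP`);
* the semantics (`exists_colQuery_iff`): on the tables `E = ` a bit matrix, `K = [c < k]`, the query
  holds iff the matrix is symmetric, irreflexive and its graph is `k`-colourable;
* the transcoder `toColQFn ∈ FP` (brick algebra: guards by `eqPairFn`, the bits `[c < k]` by a
  `Brick.foldLoop`): a CHROMATIC NUMBER instance code `⟨⟨⌜n⌝, adjacency bits⟩, ⌜k⌝⟩` is sent to the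
  structure code `⟨⌜n⌝, adjacency bits ++ [0 < k] ⋯ [n-1 < k]⟩`, everything else to a non-code;
* **`CHROMATIC_karpReducible_COLQ : CHROMATIC ≤ₚ COLQ`** and **`CHROMATIC_mem_NP : CHROMATIC ∈ NP`**.

## References

* [Karp1972] R. M. Karp, *Reducibility among combinatorial problems* (1972), §3 (the problems are
  in NP: "a nondeterministic algorithm … guesses … and checks"), §4 Main Theorem, problem 12.
* [Libkin2004] L. Libkin, *Elements of Finite Model Theory*, Springer 2004, Thm. 9.6 (proof, first
  part, p. 170: `∃SO ⊆ NP`); §9.1 (3-colourability as the `∃SO` sentence `∃ R ∃ G ∃ B …`).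
* [AroraBarakCC2009] S. Arora, B. Barak, *Computational Complexity*, CUP 2009, Def. 2.1, Thm. 2.8,
  §1.3 (polynomial time is closed under composition and bounded loops).
-/

noncomputable section

namespace Literature.Computability.Complexity

namespace ChromaticNP

open _root_.Computability Polynomial Brick OracleCompose
open Literature.ModelTheory.FiniteModelTheory Literature.Computability.Cryptography
open scoped Notation

/-! ### The vocabulary and the query -/

/-- The input vocabulary: a binary relation `E` (adjacency) and a unary relation `K` (the allowed
colours). [folklore] -/
abbrev colVocab : List ℕ := [2, 1]

/-- The witness vocabulary: one binary relation `C` ("node `a` has colour `c`"). [cite: Libkin2004,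
§9.1 (colourability in ∃SO)] -/
abbrev witVocab : List ℕ := [2]

/-- The symbol `E`. [folklore] -/
def iE : Fin colVocab.length := ⟨0, by decide⟩
/-- The symbol `K`. [folklore] -/
def iK : Fin colVocab.length := ⟨1, by decide⟩
/-- The symbol `C`. [folklore] -/
def iC : Fin witVocab.length := ⟨0, by decide⟩

variable {n : ℕ}

/-- The adjacency table. [folklore] -/
def E (R : RelTables colVocab n) (a b : Fin n) : Bool := R iE ![a, b]
/-- The colour-bound table. [folklore] -/
def K (R : RelTables colVocab n) (c : Fin n) : Bool := R iK ![c]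
/-- The guessed colouring table. [folklore] -/
def Cl (W : RelTables witVocab n) (a c : Fin n) : Bool := W iC ![a, c]

/-- **The colourability query** `∃ C [ E symmetric ∧ E irreflexive ∧ ∀ a ∃ c (K c ∧ C a c) ∧
∀ a b c ¬(E a b ∧ C a c ∧ C b c) ]` (its first-order part, as a closed query on the joint structure).
[cite: Libkin2004, §9.1 (colourability in ∃SO)] -/
def colQuery : JQuery colVocab witVocab Empty := fun n R W _ =>
  (∀ a b : Fin n, E R a b = true → E R b a = true) ∧ (∀ a : Fin n, ¬ E R a a = true) ∧
    (∀ a : Fin n, ∃ c : Fin n, K R c = true ∧ Cl W a c = true) ∧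
      ∀ a b c : Fin n, E R a b = true → Cl W a c = true → ¬ Cl W b c = true

/-- Every witness symbol is binary. [folklore] -/
theorem get_wit (s : Fin witVocab.length) : witVocab.get s = 2 := by
  match s with
  | ⟨0, _⟩ => rfl

/-- The witness tables of a Boolean function of two nodes. [folklore] -/
def witOf (f : Fin n → Fin n → Bool) : RelTables witVocab n := fun s w =>
  f (w (Fin.cast (get_wit s).symm 0)) (w (Fin.cast (get_wit s).symm 1))

/-- `Cl (witOf f) = f`. [folklore] -/
@[simp] theorem Cl_witOf (f : Fin n → Fin n → Bool) (a c : Fin n) : Cl (witOf f) a c = f a c := rfl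

/-- The atom `E x y` is definable. [folklore] -/
theorem isDef_E {α : Type} (x y : α) : JQuery.IsDef (fun _ (R : RelTables colVocab _)
    (_ : RelTables witVocab _) (v : α → _) => E R (v x) (v y) = true) :=
  (JQuery.isDef_inRel iE ![x, y]).of_iff fun n R W v => by
    have h : (v ∘ ![x, y] : Fin (colVocab.get iE) → Fin n) = ![v x, v y] := by
      funext i; fin_cases i <;> rfl
    unfold E
    rw [h]

/-- The atom `K x` is definable. [folklore] -/
theorem isDef_K {α : Type} (x : α) : JQuery.IsDef (fun _ (R : RelTables colVocab _)
    (_ : RelTables witVocab _) (v : α → _) => K R (v x) = true) :=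
  (JQuery.isDef_inRel iK ![x]).of_iff fun n R W v => by
    have h : (v ∘ ![x] : Fin (colVocab.get iK) → Fin n) = ![v x] := by
      funext i; fin_cases i; rfl
    unfold K
    rw [h]

/-- The atom `C x y` is definable. [folklore] -/
theorem isDef_Cl {α : Type} (x y : α) : JQuery.IsDef (fun _ (_ : RelTables colVocab _)
    (W : RelTables witVocab _) (v : α → _) => Cl W (v x) (v y) = true) :=
  (JQuery.isDef_witRel iC ![x, y]).of_iff fun n R W v => by
    have h : (v ∘ ![x, y] : Fin (witVocab.get iC) → Fin n) = ![v x, v y] := by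
      funext i; fin_cases i <;> rfl
    unfold Cl
    rw [h]

/-- **The query is first-order** (closure of definable queries under connectives and quantifier
blocks, `ESODefinability.lean`). [cite: Libkin2004, §9.1 (colourability in ∃SO)] -/
theorem isDef_colQuery : colQuery.IsDef := by
  -- `E` symmetric
  have h1 : JQuery.IsDef (fun n (R : RelTables colVocab n) (_ : RelTables witVocab n) (_ : Empty → Fin n) =>
      ∀ a b : Fin n, E R a b = true → E R b a = true) := by
    refine ((isDef_E (α := Empty ⊕ Fin 2) (Sum.inr 0) (Sum.inr 1)).imp
      (isDef_E (Sum.inr 1) (Sum.inr 0))).alls.of_iff fun n R W v => ?_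
    simp only [Sum.elim_inr]
    exact ⟨fun h a b => by simpa using h ![a, b], fun h w => h (w 0) (w 1)⟩
  -- `E` irreflexive
  have h2 : JQuery.IsDef (fun n (R : RelTables colVocab n) (_ : RelTables witVocab n) (_ : Empty → Fin n) =>
      ∀ a : Fin n, ¬ E R a a = true) := by
    refine ((isDef_E (α := Empty ⊕ Unit) (Sum.inr ()) (Sum.inr ())).not).all.of_iff fun n R W v => ?_
    simp only [Sum.elim_inr]
  -- every node has an allowed colour
  have h3 : JQuery.IsDef (fun n (R : RelTables colVocab n) (W : RelTables witVocab n) (_ : Empty → Fin n) =>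
      ∀ a : Fin n, ∃ c : Fin n, K R c = true ∧ Cl W a c = true) := by
    refine ((isDef_K (α := (Empty ⊕ Unit) ⊕ Unit) (Sum.inr ())).and
      (isDef_Cl (Sum.inl (Sum.inr ())) (Sum.inr ()))).ex.all.of_iff fun n R W v => ?_
    simp only [Sum.elim_inr, Sum.elim_inl]
  -- adjacent nodes have different colours
  have h4 : JQuery.IsDef (fun n (R : RelTables colVocab n) (W : RelTables witVocab n) (_ : Empty → Fin n) =>
      ∀ a b c : Fin n, E R a b = true → Cl W a c = true → ¬ Cl W b c = true) := by
    refine (((isDef_E (α := Empty ⊕ Fin 3) (Sum.inr 0) (Sum.inr 1)).imp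
      ((isDef_Cl (Sum.inr 0) (Sum.inr 2)).imp (isDef_Cl (Sum.inr 1) (Sum.inr 2)).not)).alls).of_iff
      fun n R W v => ?_
    simp only [Sum.elim_inr]
    exact ⟨fun h a b c => by simpa using h ![a, b, c], fun h w => h (w 0) (w 1) (w 2)⟩
  exact ((h1.and h2).and (h3.and h4)).of_iff fun n R W v => by simp only [colQuery, and_assoc]

/-- **The language of the colourability query**: codes of finite `[2,1]`-structures `⟨n, (E, K)⟩`
with `E` symmetric irreflexive whose graph has a proper colouring by `K`-colours.
[cite: Libkin2004, Thm. 9.6 (proof, first part, p. 170)] -/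
def COLQ : Language Bool := (encodingSNPInstance colVocab).toLanguage (classOf colQuery)

/-- **`COLQ ∈ NP`** by Fagin's easy direction (`eso_subset_NP_holds`). [cite: Libkin2004, Thm. 9.6
(proof, first part, p. 170)] -/
theorem COLQ_mem_NP : COLQ ∈ Nondeterministic.NP := by
  obtain ⟨Φ, hΦ⟩ := IsESODefinable.of_isDef isDef_colQuery
  have har : IsNondegenerateVocab colVocab := ⟨2, by simp, by norm_num⟩
  have h := eso_subset_NP_holds colVocab har Φ
  have hl : Φ.language = COLQ := by rw [ESOSentence.language, hΦ]; rfl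
  rwa [hl] at h

/-! ### Semantics of the query on a bit matrix -/

/-- The graph of a (symmetric, irreflexive) bit matrix: Mathlib's `SimpleGraph.fromRel` of the
relation "bit `(i, j)` is set" (which symmetrises and removes the diagonal; on the matrices that
matter both are vacuous). [folklore] -/
def graphOfBits (bit : Fin n → Fin n → Bool) : SimpleGraph (Fin n) :=
  SimpleGraph.fromRel fun i j => bit i j = true

/-- Adjacency in the graph of a symmetric irreflexive bit matrix is the bit. [folklore] -/
theorem graphOfBits_adj {bit : Fin n → Fin n → Bool} (hs : ∀ i j, bit i j = true → bit j i = true)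
    (hi : ∀ i, ¬ bit i i = true) (i j : Fin n) : (graphOfBits bit).Adj i j ↔ bit i j = true := by
  rw [graphOfBits, SimpleGraph.fromRel_adj]
  constructor
  · rintro ⟨-, h | h⟩
    · exact h
    · exact hs _ _ h
  · intro h
    exact ⟨fun e => hi j (by rw [e] at h; exact h), Or.inl h⟩

/-- **Semantics of the query.** On tables whose `E` is `E a b = bit b a` and whose `K` is
`K c = [c < k]`, some witness satisfies `colQuery` iff the matrix is symmetric and irreflexive and
its graph is `k`-colourable (a colouring by `< n` of the `k` colours always exists when one by `k`
colours does: use at most `n` colours). [cite: Libkin2004, §9.1 (colourability in ∃SO)] -/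
theorem exists_colQuery_iff {R : RelTables colVocab n} {bit : Fin n → Fin n → Bool} {k : ℕ}
    (hE : ∀ a b, E R a b = bit b a) (hK : ∀ c : Fin n, K R c = decide (c.val < k)) :
    (∃ W : RelTables witVocab n, colQuery R W Empty.elim) ↔
      (∀ i j, bit i j = true → bit j i = true) ∧ (∀ i, ¬ bit i i = true) ∧ (graphOfBits bit).Colorable k := by
  simp only [colQuery, hE, hK, decide_eq_true_eq]
  constructor
  · rintro ⟨W, hs, hi, hex, hval⟩
    have hs' : ∀ i j, bit i j = true → bit j i = true := fun i j h => hs j i h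
    refine ⟨hs', hi, ?_⟩
    choose f hf using hex
    refine ⟨SimpleGraph.Coloring.mk (fun a => (⟨(f a).val, (hf a).1⟩ : Fin k)) fun {a b} hab e => ?_⟩
    have hfab : f a = f b := Fin.ext (by simpa using congrArg Fin.val e)
    have hba : bit b a = true := hs' _ _ ((graphOfBits_adj hs' hi a b).1 hab)
    exact hval a b (f a) hba (hf a).2 (hfab ▸ (hf b).2)
  · rintro ⟨hs, hi, hcol⟩
    -- a colouring by `min k n` colours
    have hcol' : (graphOfBits bit).Colorable (min k n) := by
      rcases le_total k n with h | h
      · rwa [Nat.min_eq_left h]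
      · rw [Nat.min_eq_right h]
        simpa using (graphOfBits bit).colorable_of_fintype
    obtain ⟨C⟩ := hcol'
    refine ⟨witOf fun a c => decide ((C a).val = c.val), fun a b h => hs _ _ h, hi, fun a => ?_,
      fun a b c hba hac hbc => ?_⟩
    · refine ⟨⟨(C a).val, lt_of_lt_of_le (C a).2 (Nat.min_le_right _ _)⟩,
        lt_of_lt_of_le (C a).2 (Nat.min_le_left _ _), ?_⟩
      simp
    · simp only [Cl_witOf, decide_eq_true_eq] at hac hbc
      have hab : (graphOfBits bit).Adj a b := (graphOfBits_adj hs hi a b).2 (hs _ _ hba)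
      exact C.valid hab (Fin.ext (hac.trans hbc.symm))

/-! ### Bit matrices, graph codes and the tables of the output -/

/-- The entry `(i, j)` of an `n × n` bit matrix given row-major as a string of length `n²` (the
position of `(i, j)` is `j + n i = finProdFinEquiv (i, j)`, the layout of `encodingGraphFin`).
[cite: AroraBarakCC2009, §0.1 (adjacency matrix)] -/
def bitOf (adj : List Bool) (h : adj.length = n * n) (i j : Fin n) : Bool :=
  adj[(finProdFinEquiv (i, j)).val]'(by rw [h]; exact (finProdFinEquiv (i, j)).2)

/-- The value of the row-major position of `(i, j)`. [folklore] -/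
theorem val_finProdFinEquiv (i j : Fin n) : ((finProdFinEquiv (i, j) : Fin (n * n)) : ℕ) = j + n * i := rfl

/-- The adjacency bits of a graph (`encodingGraphFin`). [folklore] -/
theorem encodingGraphFin_encode_eq (G : SimpleGraph (Fin n)) :
    (encodingGraphFin n).encode G = List.ofFn fun t : Fin (n * n) =>
      @decide (G.Adj (finProdFinEquiv.symm t).1 (finProdFinEquiv.symm t).2) (Classical.propDecidable _) := rfl

/-- The adjacency bits have length `n²`. [folklore] -/
theorem length_encodingGraphFin_encode (G : SimpleGraph (Fin n)) : ((encodingGraphFin n).encode G).length = n * n := by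
  rw [encodingGraphFin_encode_eq, List.length_ofFn]

/-- **The bits of a graph code are its adjacencies.** [cite: AroraBarakCC2009, §0.1 (adjacency matrix)] -/
theorem bitOf_encode (G : SimpleGraph (Fin n)) (i j : Fin n) :
    bitOf ((encodingGraphFin n).encode G) (length_encodingGraphFin_encode G) i j = true ↔ G.Adj i j := by
  unfold bitOf
  simp only [encodingGraphFin_encode_eq, List.getElem_ofFn, Fin.eta, Equiv.symm_apply_apply, decide_eq_true_eq]

/-- **A symmetric irreflexive bit matrix is the code of its graph.** [cite: AroraBarakCC2009, §0.1
(adjacency matrix)] -/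
theorem encode_graphOfBits {adj : List Bool} (h : adj.length = n * n)
    (hs : ∀ i j, bitOf adj h i j = true → bitOf adj h j i = true) (hi : ∀ i, ¬ bitOf adj h i i = true) :
    (encodingGraphFin n).encode (graphOfBits (bitOf adj h)) = adj := by
  have hadj : adj = List.ofFn (fun t : Fin (n * n) => adj[t.val]'(by rw [h]; exact t.2)) := by
    apply List.ext_getElem (by rw [List.length_ofFn, h])
    intro t h1 h2
    rw [List.getElem_ofFn]
  rw [encodingGraphFin_encode_eq]
  conv_rhs => rw [hadj]
  refine congrArg List.ofFn (funext fun t => ?_)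
  obtain ⟨⟨i, j⟩, rfl⟩ := finProdFinEquiv.surjective t
  rw [Equiv.symm_apply_apply, Bool.eq_iff_iff, @Bool.decide_iff _ (Classical.propDecidable _),
    graphOfBits_adj hs hi]
  rfl

/-- The bit matrix of a graph code is symmetric and irreflexive, and its graph is the graph.
[cite: AroraBarakCC2009, §0.1 (adjacency matrix)] -/
theorem bitOf_props (G : SimpleGraph (Fin n)) {adj : List Bool} (he : adj = (encodingGraphFin n).encode G)
    (h : adj.length = n * n) :
    (∀ i j, bitOf adj h i j = true → bitOf adj h j i = true) ∧ (∀ i, ¬ bitOf adj h i i = true) ∧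
      graphOfBits (bitOf adj h) = G := by
  subst he
  have hb : ∀ i j, bitOf ((encodingGraphFin n).encode G) h i j = true ↔ G.Adj i j := bitOf_encode G
  have hs : ∀ i j, bitOf _ h i j = true → bitOf _ h j i = true := fun i j hij => (hb j i).2 ((hb i j).1 hij).symm
  have hi : ∀ i, ¬ bitOf _ h i i = true := fun i hii => G.irrefl ((hb i i).1 hii)
  refine ⟨hs, hi, ?_⟩
  ext i j
  rw [graphOfBits_adj hs hi, hb]

/-- `tableBits [2, 1] n = n² + n`. [folklore] -/
theorem tableBits_colVocab (n : ℕ) : tableBits colVocab n = n * n + n := by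
  simp [tableBits, Fin.sum_univ_two, List.get_eq_getElem, pow_two]

/-- **The tables of the output word** `adjacency bits ++ [0 < k] ⋯ [n-1 < k]` (by `tablesOfBits`).
[folklore] -/
def tablesOf (adj : List Bool) (h : adj.length = n * n) (k : ℕ) : RelTables colVocab n :=
  tablesOfBits colVocab n (adj ++ List.ofFn fun c : Fin n => decide (c.val < k))
    (by rw [List.length_append, List.length_ofFn, h, tableBits_colVocab])

/-- Reading a table entry of `tablesOfBits`. [folklore] -/
theorem tablesOfBits_apply {ar : List ℕ} (t : List Bool) (h : t.length = tableBits ar n) (s : Fin ar.length)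
    (w : Fin (ar.get s) → Fin n) :
    tablesOfBits ar n t h s w = t[tableOffset ar n s + (finFunctionFinEquiv w : ℕ)]'(by
      rw [h, ← val_finSigmaFinEquiv_table]; exact (finSigmaFinEquiv _).2) := by
  have e := relTablesEquiv_apply_table (tablesOfBits ar n t h) s w
  rw [← e]
  unfold tablesOfBits
  rw [Equiv.apply_symm_apply]
  simp only [val_finSigmaFinEquiv_table]

/-- The offset of `E` is `0`. [folklore] -/
theorem tableOffset_iE (n : ℕ) : tableOffset colVocab n iE = 0 := rfl

/-- The offset of `K` is `n²`. [folklore] -/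
theorem tableOffset_iK (n : ℕ) : tableOffset colVocab n iK = n * n := by
  simp [tableOffset, iK, pow_two, List.get_eq_getElem]

/-- **The `E`-table of the output is the transposed bit matrix** (Mathlib's `finFunctionFinEquiv`
lists the FIRST argument fastest). [folklore] -/
theorem E_tablesOf (adj : List Bool) (h : adj.length = n * n) (k : ℕ) (a b : Fin n) :
    E (tablesOf adj h k) a b = bitOf adj h b a := by
  unfold E tablesOf
  rw [tablesOfBits_apply]
  have hidx : tableOffset colVocab n iE + (@finFunctionFinEquiv n (colVocab.get iE) ![a, b] : ℕ)
      = a.val + n * b.val := by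
    rw [tableOffset_iE, finFunctionFinEquiv_apply]
    show 0 + ∑ i : Fin 2, ((![a, b] : Fin 2 → Fin n) i : ℕ) * n ^ (i : ℕ) = _
    simp [Fin.sum_univ_two]
    ring
  have hlt : a.val + n * b.val < adj.length := by
    rw [h]
    have := (finProdFinEquiv (b, a)).2
    rwa [val_finProdFinEquiv] at this
  simp only [hidx]
  rw [List.getElem_append_left hlt]
  rfl

/-- **The `K`-table of the output is `[c < k]`.** [folklore] -/
theorem K_tablesOf (adj : List Bool) (h : adj.length = n * n) (k : ℕ) (c : Fin n) :
    K (tablesOf adj h k) c = decide (c.val < k) := by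
  unfold K tablesOf
  rw [tablesOfBits_apply]
  have hidx : tableOffset colVocab n iK + (@finFunctionFinEquiv n (colVocab.get iK) ![c] : ℕ)
      = adj.length + c.val := by
    rw [tableOffset_iK, finFunctionFinEquiv_apply, h]
    show n * n + ∑ i : Fin 1, ((![c] : Fin 1 → Fin n) i : ℕ) * n ^ (i : ℕ) = _
    simp
  simp only [hidx]
  rw [List.getElem_append_right (by omega)]
  simp

/-- **The code of the output tables.** [folklore] -/
theorem encode_tablesOf (adj : List Bool) (h : adj.length = n * n) (k : ℕ) :
    (encodingSNPInstance colVocab).encode ⟨n, tablesOf adj h k⟩ =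
      boolPair (encodeNat n) (adj ++ List.ofFn fun c : Fin n => decide (c.val < k)) := by
  change boolPair (encodeNat n) ((encodingRelTables colVocab n).encode (tablesOf adj h k)) = _
  rw [tablesOf, encode_tablesOfBits]

/-- **Membership of the output in `COLQ`**: symmetric, irreflexive, `k`-colourable.
[cite: Libkin2004, §9.1 (colourability in ∃SO)] -/
theorem tablesOf_mem_classOf_iff (adj : List Bool) (h : adj.length = n * n) (k : ℕ) :
    (⟨n, tablesOf adj h k⟩ : SNPInstance colVocab) ∈ classOf colQuery ↔
      (∀ i j, bitOf adj h i j = true → bitOf adj h j i = true) ∧ (∀ i, ¬ bitOf adj h i i = true) ∧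
        (graphOfBits (bitOf adj h)).Colorable k := by
  rw [mem_classOf_iff]
  exact exists_colQuery_iff (E_tablesOf adj h k) (K_tablesOf adj h k)

/-! ### The transcoder (brick algebra) -/

/-- On input `x = ⟨⟨u, adj⟩, kk⟩`: the numeral `u`. [folklore] -/
def vtxNumF : List Bool → List Bool := fstF ∘ fstF
/-- On input `x`: the adjacency bits `adj`. [folklore] -/
def adjBitsF : List Bool → List Bool := sndF ∘ fstF
/-- On input `x`: the numeral `kk`. [folklore] -/
def colNumF : List Bool → List Bool := sndF

/-- Guard 1: `x` is a well-formed pair. [folklore] -/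
def g1 : List Bool → List Bool := eqPairFn ∘ fanoutFn (fanoutFn fstF sndF) id
/-- Guard 2: the first component of `x` is a well-formed pair. [folklore] -/
def g2 : List Bool → List Bool := eqPairFn ∘ fanoutFn (fanoutFn vtxNumF adjBitsF) fstF
/-- Guard 3: `u` is a canonical numeral. [folklore] -/
def g3 : List Bool → List Bool := eqPairFn ∘ fanoutFn (canonF ∘ vtxNumF) vtxNumF
/-- Guard 4: `kk` is a canonical numeral. [folklore] -/
def g4 : List Bool → List Bool := eqPairFn ∘ fanoutFn (canonF ∘ colNumF) colNumF
/-- Guard 5: `|adj| = ⟦u⟧²`. [folklore] -/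
def g5 : List Bool → List Bool := eqPairFn ∘ fanoutFn (lenBinF ∘ adjBitsF) (prodFn ∘ fanoutFn vtxNumF vtxNumF)
/-- **The guard**: the conjunction of the five tests. [cite: AroraBarakCC2009, §1.3] -/
def chromGuardF : List Bool → List Bool := andFn g1 (andFn g2 (andFn g3 (andFn g4 g5)))

/-- The piece `[c < k]` on `⟨x, 1ᶜ⟩` (`ltFn` on `⟨⌜c⌝, kk⟩`). [folklore] -/
def kbPiece : List Bool → List Bool := ltFn ∘ fanoutFn (lenBinF ∘ sndF) (colNumF ∘ fstF)
/-- The initial record `⟨x, ⟨u, ⟨1⁰, ε⟩⟩⟩` of the fold over the colours. [folklore] -/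
def kbInit : List Bool → List Bool := fanoutFn id (fanoutFn vtxNumF fun _ => boolPair [] [])
/-- **The bits `[0 < k] ⋯ [n-1 < k]`** by the concatenation fold `Brick.foldLoop appF (clipF 1 kbPiece) X`.
[cite: AroraBarakCC2009, §1.3 (bounded loops)] -/
def kbF : List Bool → List Bool := sndPow 2 ∘ foldLoop appF (clipF 1 kbPiece) X ∘ kbInit
/-- The output on a guarded input: `⟨u, adj ++ kbF x⟩`. [folklore] -/
def structF : List Bool → List Bool := fanoutFn vtxNumF fun z => adjBitsF z ++ kbF z
/-- **The transcoder** `CHROMATIC NUMBER → COLQ`: the structure code on guarded inputs, the non-code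
`[1]` otherwise. [cite: AroraBarakCC2009, Thm. 2.8] -/
def toColQFn : List Bool → List Bool := iteFn chromGuardF structF fun _ => [true]

/-- `vtxNumF ∈ FP`. [cite: AroraBarakCC2009, §1.3] -/
theorem vtxNumF_mem_FP : vtxNumF ∈ FP := comp_mem_FP fstF_mem_FP fstF_mem_FP
/-- `adjBitsF ∈ FP`. [cite: AroraBarakCC2009, §1.3] -/
theorem adjBitsF_mem_FP : adjBitsF ∈ FP := comp_mem_FP sndF_mem_FP fstF_mem_FP
/-- `colNumF ∈ FP`. [cite: AroraBarakCC2009, §1.3] -/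
theorem colNumF_mem_FP : colNumF ∈ FP := sndF_mem_FP
/-- `g1 ∈ FP`. [cite: AroraBarakCC2009, §1.3] -/
theorem g1_mem_FP : g1 ∈ FP :=
  comp_mem_FP eqPairFn_mem_FP (fanoutFn_mem_FP (fanoutFn_mem_FP fstF_mem_FP sndF_mem_FP) id_mem_FP)
/-- `g2 ∈ FP`. [cite: AroraBarakCC2009, §1.3] -/
theorem g2_mem_FP : g2 ∈ FP :=
  comp_mem_FP eqPairFn_mem_FP (fanoutFn_mem_FP (fanoutFn_mem_FP vtxNumF_mem_FP adjBitsF_mem_FP) fstF_mem_FP)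
/-- `g3 ∈ FP`. [cite: AroraBarakCC2009, §1.3] -/
theorem g3_mem_FP : g3 ∈ FP :=
  comp_mem_FP eqPairFn_mem_FP (fanoutFn_mem_FP (comp_mem_FP canonF_mem_FP vtxNumF_mem_FP) vtxNumF_mem_FP)
/-- `g4 ∈ FP`. [cite: AroraBarakCC2009, §1.3] -/
theorem g4_mem_FP : g4 ∈ FP :=
  comp_mem_FP eqPairFn_mem_FP (fanoutFn_mem_FP (comp_mem_FP canonF_mem_FP colNumF_mem_FP) colNumF_mem_FP)
/-- `g5 ∈ FP`. [cite: AroraBarakCC2009, §1.3] -/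
theorem g5_mem_FP : g5 ∈ FP :=
  comp_mem_FP eqPairFn_mem_FP (fanoutFn_mem_FP (comp_mem_FP lenBinF_mem_FP adjBitsF_mem_FP)
    (comp_mem_FP prodFn_mem_FP (fanoutFn_mem_FP vtxNumF_mem_FP vtxNumF_mem_FP)))
/-- `chromGuardF ∈ FP`. [cite: AroraBarakCC2009, §1.3] -/
theorem chromGuardF_mem_FP : chromGuardF ∈ FP :=
  andFn_mem_FP g1_mem_FP (andFn_mem_FP g2_mem_FP (andFn_mem_FP g3_mem_FP (andFn_mem_FP g4_mem_FP g5_mem_FP)))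
/-- `kbPiece ∈ FP`. [cite: AroraBarakCC2009, §1.3] -/
theorem kbPiece_mem_FP : kbPiece ∈ FP :=
  comp_mem_FP ltFn_mem_FP (fanoutFn_mem_FP (comp_mem_FP lenBinF_mem_FP sndF_mem_FP) (comp_mem_FP colNumF_mem_FP fstF_mem_FP))
/-- `kbInit ∈ FP`. [cite: AroraBarakCC2009, §1.3] -/
theorem kbInit_mem_FP : kbInit ∈ FP :=
  fanoutFn_mem_FP id_mem_FP (fanoutFn_mem_FP vtxNumF_mem_FP (const_mem_FP _))
/-- **`kbF ∈ FP`** (`foldLoop_clipF_mem_FP`). [cite: AroraBarakCC2009, §1.3 (bounded loops)] -/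
theorem kbF_mem_FP : kbF ∈ FP :=
  comp_mem_FP (sndPow_mem_FP 2) (comp_mem_FP
    (foldLoop_clipF_mem_FP 1 appF_mem_FP length_appF_le kbPiece_mem_FP _) kbInit_mem_FP)
/-- `structF ∈ FP`. [cite: AroraBarakCC2009, §1.3] -/
theorem structF_mem_FP : structF ∈ FP := fanoutFn_mem_FP vtxNumF_mem_FP (append_mem_FP adjBitsF_mem_FP kbF_mem_FP)
/-- **`toColQFn ∈ FP`.** [cite: AroraBarakCC2009, Thm. 2.8] -/
theorem toColQFn_mem_FP : toColQFn ∈ FP := iteFn_mem_FP chromGuardF_mem_FP structF_mem_FP (const_mem_FP _)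

/-! ### Values of the bricks -/

/-- An `eqPairFn` test of two computed strings is the comparison bit. [folklore] -/
theorem eqTest_apply (f g : List Bool → List Bool) (z : List Bool) :
    (eqPairFn ∘ fanoutFn f g) z = [decide (f z = g z)] := by
  rw [Function.comp_apply, fanoutFn_apply, eqPairFn_boolPair]

/-- **The guard is true iff** `x = ⟨⟨u, adj⟩, kk⟩` with `u`, `kk` canonical numerals and
`|adj| = ⟦u⟧²`. [folklore] -/
theorem chromGuardF_eq_true_iff (z : List Bool) : chromGuardF z = [true] ↔
    boolPair (boolPair (vtxNumF z) (adjBitsF z)) (colNumF z) = z ∧ canonF (vtxNumF z) = vtxNumF z ∧ canonF (colNumF z) = colNumF z ∧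
      (adjBitsF z).length = bitsToNat (vtxNumF z) * bitsToNat (vtxNumF z) := by
  have e1 : g1 z = [decide (boolPair (fstF z) (sndF z) = z)] := by
    rw [g1, eqTest_apply, fanoutFn_apply]; rfl
  have e2 : g2 z = [decide (boolPair (vtxNumF z) (adjBitsF z) = fstF z)] := by
    rw [g2, eqTest_apply, fanoutFn_apply]
  have e3 : g3 z = [decide (canonF (vtxNumF z) = vtxNumF z)] := by rw [g3, eqTest_apply]; rfl
  have e4 : g4 z = [decide (canonF (colNumF z) = colNumF z)] := by rw [g4, eqTest_apply]; rfl
  have e5 : g5 z = [decide ((adjBitsF z).length = bitsToNat (vtxNumF z) * bitsToNat (vtxNumF z))] := by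
    rw [g5, eqTest_apply]
    simp only [Function.comp_apply, lenBinF_apply, fanoutFn_apply, prodFn_boolPair, encodeNat_inj]
  rw [chromGuardF, andFn_apply e1 (andFn_apply e2 (andFn_apply e3 (andFn_apply e4 e5)))]
  simp only [List.cons.injEq, and_true, Bool.and_eq_true, decide_eq_true_eq, colNumF]
  constructor
  · rintro ⟨h1, h2, h3, h4, h5⟩
    exact ⟨by rw [h2, h1], h3, h4, h5⟩
  · rintro ⟨h, h3, h4, h5⟩
    have hf : fstF z = boolPair (vtxNumF z) (adjBitsF z) := by conv_lhs => rw [← h]; rw [fstF_boolPair]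
    refine ⟨?_, hf.symm, h3, h4, h5⟩
    rw [hf]
    exact h

/-- An `eqPairFn` test is one-bit. [folklore] -/
theorem oneBit_eqTest (f g : List Bool → List Bool) : OneBit (eqPairFn ∘ fanoutFn f g) :=
  fun z => ⟨_, eqTest_apply f g z⟩

/-- The guard is one-bit. [folklore] -/
theorem oneBit_chromGuardF : OneBit chromGuardF :=
  oneBit_andFn (oneBit_eqTest _ _) (oneBit_andFn (oneBit_eqTest _ _) (oneBit_andFn (oneBit_eqTest _ _)
    (oneBit_andFn (oneBit_eqTest _ _) (oneBit_eqTest _ _))))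

/-- The piece `[c < k]` on `⟨x, 1ᶜ⟩`. [folklore] -/
theorem kbPiece_boolPair (z : List Bool) (c : ℕ) :
    kbPiece (boolPair z (ones c)) = [decide (c < bitsToNat (colNumF z))] := by
  simp [kbPiece, fanoutFn_apply, lenBinF_apply]

/-- A concatenation of one-bit pieces is a `List.ofFn`. [folklore] -/
theorem ccat_singleton (f : ℕ → Bool) : ∀ m : ℕ, ccat (fun c => [f c]) m = List.ofFn fun c : Fin m => f c.val
  | 0 => rfl
  | m + 1 => by rw [ccat_succ, ccat_singleton f m, List.ofFn_succ', List.concat_eq_append]; rfl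

/-- **Value of the colour fold**: on an input whose `u` is the numeral of `m ≤ |x|`, the bits
`[0 < k] ⋯ [m-1 < k]`, `k = ⟦kk⟧`. [folklore] -/
theorem kbF_apply {z : List Bool} {m : ℕ} (hu : vtxNumF z = encodeNat m) (hm : m ≤ z.length) :
    kbF z = List.ofFn fun c : Fin m => decide (c.val < bitsToNat (colNumF z)) := by
  have hinit : kbInit z = boolPair z (boolPair (encodeNat m) (boolPair (ones 0) [])) := by
    simp [kbInit, fanoutFn_apply, hu]
  have hm' : m ≤ X.eval z.length := by rwa [eval_X]
  rw [kbF, Function.comp_apply, Function.comp_apply, hinit, foldLoop_apply _ _ hm', sndPow_succ_boolPair,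
    sndPow_succ_boolPair, sndPow_zero_boolPair, foldAcc_clipF, foldAcc_appF, List.nil_append]
  · simp only [Nat.zero_add, kbPiece_boolPair]
    exact ccat_singleton _ m
  · intro j _ _
    rw [kbPiece_boolPair]
    simp

/-- **Value of the transcoder on a guarded input.** [folklore] -/
theorem toColQFn_of_guard {z : List Bool} (h : chromGuardF z = [true]) : toColQFn z = boolPair (vtxNumF z) (adjBitsF z ++ kbF z) := by
  rw [toColQFn, iteFn_apply_true h, structF, fanoutFn_apply]

/-- Value of the transcoder on an unguarded input. [folklore] -/
theorem toColQFn_of_not_guard {z : List Bool} (h : chromGuardF z = [false]) : toColQFn z = [true] := by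
  rw [toColQFn, iteFn_apply_false h]

/-- The projections of a code `⟨⟨u, adj⟩, kk⟩`. [folklore] -/
theorem proj_boolPair (u adj kk : List Bool) :
    vtxNumF (boolPair (boolPair u adj) kk) = u ∧ adjBitsF (boolPair (boolPair u adj) kk) = adj ∧
      colNumF (boolPair (boolPair u adj) kk) = kk := by
  simp [vtxNumF, adjBitsF, colNumF]

/-- A member of `COLQ` has length `≥ 2` (it is a pair); so `[1] ∉ COLQ`. [folklore] -/
theorem singleton_not_mem_COLQ : [true] ∉ COLQ := by
  rintro ⟨⟨m, R⟩, -, h⟩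
  have := congrArg List.length h
  change (boolPair (encodeNat m) _).length = 1 at this
  rw [length_boolPair] at this
  omega

/-- Unfolding membership in `CHROMATIC`: the codes of `k`-colourable graphs. [cite: Karp1972, §4 Main
Theorem, problem 12] -/
theorem mem_CHROMATIC_iff (x : List Bool) : x ∈ CHROMATIC ↔ ∃ (m : ℕ) (G : SimpleGraph (Fin m)) (k : ℕ),
    G.Colorable k ∧ boolPair (boolPair (encodeNat m) ((encodingGraphFin m).encode G)) (encodeNat k) = x := by
  constructor
  · rintro ⟨⟨⟨m, G⟩, k⟩, hc, rfl⟩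
    exact ⟨m, G, k, hc, rfl⟩
  · rintro ⟨m, G, k, hc, rfl⟩
    exact ⟨(⟨m, G⟩, k), hc, rfl⟩

/-! ### The reduction and `CHROMATIC ∈ NP` -/

/-- **`CHROMATIC ≤ₚ COLQ`.** [cite: AroraBarakCC2009, Thm. 2.8] -/
theorem CHROMATIC_karpReducible_COLQ : CHROMATIC ≤ₚ COLQ := by
  refine ⟨toColQFn, toColQFn_mem_FP, fun x => ?_⟩
  show x ∈ CHROMATIC ↔ toColQFn x ∈ COLQ
  by_cases hg : chromGuardF x = [true]
  · obtain ⟨hx, hu, hk, hlen⟩ := (chromGuardF_eq_true_iff x).1 hg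
    set u := vtxNumF x with hu_def
    set adj := adjBitsF x with hadj_def
    set kk := colNumF x with hkk_def
    have hu' : u = encodeNat (decodeNat u) := by rw [← canonF_eq_encodeNat_decodeNat]; exact hu.symm
    have hk' : kk = encodeNat (decodeNat kk) := by rw [← canonF_eq_encodeNat_decodeNat]; exact hk.symm
    set m := decodeNat u
    set k := decodeNat kk
    have hbu : bitsToNat u = m := by rw [hu', bitsToNat_encodeNat]
    have hbk : bitsToNat kk = k := by rw [hk', bitsToNat_encodeNat]
    rw [hbu] at hlen
    have hmx : m ≤ x.length := by
      have h1 : m ≤ m * m := by rcases Nat.eq_zero_or_pos m with h | h <;> nlinarith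
      have h2 : adj.length ≤ x.length := by
        rw [← hx, length_boolPair, length_boolPair]; omega
      omega
    have hT : toColQFn x = (encodingSNPInstance colVocab).encode ⟨m, tablesOf adj hlen k⟩ := by
      rw [toColQFn_of_guard hg, encode_tablesOf, kbF_apply hu' hmx, ← hu_def, ← hadj_def, hu', ← hkk_def, hbk]
    rw [hT, COLQ, Encoding.mem_toLanguage_iff, tablesOf_mem_classOf_iff, mem_CHROMATIC_iff]
    constructor
    · rintro ⟨m', G, k', hcol, hxe⟩
      obtain ⟨e1, e2, e3⟩ := proj_boolPair (encodeNat m') ((encodingGraphFin m').encode G) (encodeNat k')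
      rw [hxe] at e1 e2 e3
      have hm : m' = m := by
        rw [← encodeNat_inj, ← hu', hu_def, e1]
      subst hm
      have hk2 : k' = k := by
        rw [← encodeNat_inj, ← hk', hkk_def, e3]
      subst hk2
      obtain ⟨hs, hi, hG⟩ := bitOf_props G (hadj_def.trans e2) hlen
      refine ⟨hs, hi, ?_⟩
      rwa [hG]
    · rintro ⟨hs, hi, hcol⟩
      refine ⟨m, graphOfBits (bitOf adj hlen), k, hcol, ?_⟩
      rw [encode_graphOfBits hlen hs hi, ← hu', ← hk']
      exact hx
  · have hg' : chromGuardF x = [false] := by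
      rcases oneBit_chromGuardF x with ⟨b, hb⟩
      cases b
      · exact hb
      · exact absurd hb hg
    rw [toColQFn_of_not_guard hg']
    constructor
    · intro hxC
      exfalso
      obtain ⟨m, G, k, -, rfl⟩ := (mem_CHROMATIC_iff _).1 hxC
      refine hg ((chromGuardF_eq_true_iff _).2 ?_)
      obtain ⟨e1, e2, e3⟩ := proj_boolPair (encodeNat m) ((encodingGraphFin m).encode G) (encodeNat k)
      rw [e1, e2, e3]
      refine ⟨rfl, ?_, ?_, ?_⟩
      · rw [canonF_eq_encodeNat_decodeNat, decode_encodeNat]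
      · rw [canonF_eq_encodeNat_decodeNat, decode_encodeNat]
      · rw [bitsToNat_encodeNat, length_encodingGraphFin_encode]
    · intro h
      exact absurd h singleton_not_mem_COLQ

/-- **`CHROMATIC NUMBER ∈ NP`** (Karp 1972; here: `CHROMATIC ≤ₚ COLQ ∈ NP`, `NP` closed under `≤ₚ`).
[cite: Karp1972, §4 Main Theorem, problem 12] -/
theorem CHROMATIC_mem_NP : CHROMATIC ∈ Nondeterministic.NP :=
  mem_NP_of_karpReducible_holds CHROMATIC_karpReducible_COLQ COLQ_mem_NP

end ChromaticNP

end Literature.Computability.Complexity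

end
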